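import Literature.MathematicalPhysics.QuantumFieldTheory.LatticeAxialGauge
import Literature.MathematicalPhysics.QuantumFieldTheory.U1VillainMasslessPhotonD4Proofs
import Literature.MathematicalPhysics.QuantumFieldTheory.U1DualFluxEnsemble
import Literature.MathematicalPhysics.QuantumFieldTheory.CubicalCochains
import HarnessLib

/-!
# The Villain `U(1)` theory on a cube in link angles: configurations from free link angles, the
# Villain weight and the Wilson loop as functions of the real plaquette field `dθ`

Support file for the duality transformation of four-dimensional `U(1)` lattice gauge theory with
the Villain action (proof programme of the named fact
`Literature.MathematicalPhysics.QuantumFieldTheory.FrohlichSpencerU1PerimeterLawD4` and of its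
corollary `Literature.Barriers.QuantumFields.AbelianDeconfinementD4`). Fröhlich–Spencer's
functional measure (2.3), `dμ_Λ = Z⁻¹ ∏_{p ⊂ Λ} φ_β(dθ_p) ∏ dθ_{xy}`, and Wilson loop
`W = cos θ(ℒ) = Re e^{iθ(ℒ)}`, `θ(ℒ) = ∑_{p ∈ S} dθ_p` (Stokes, (2.5) and §2.3), are written in link
ANGLES and the real plaquette field `dθ`; the tree's Villain theory (`zdVillainMeasure`,
`zdVillainDensity β Λ U = ∏ φ_β(arg U_p)`) lives on `U(1)`-valued configurations. In the comb
(axial) gauge of `LatticeAxialGauge` on the cube `B_n` the link variables off the comb tree are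
free; this file parametrises them by real angles and computes the integrand:

* `AngleCfg d n` (real angles on the free edges of `B_n`), `extAngle θ` (extension by `0`: a
  comb-gauge real link field), `cfgOfAngle θ = (e^{iθ̃_e})_e : ZdGaugeConfig d Circle`, and
  `cfgOfAngle_eq_ext_ext₁` (it is the `LatticeAxialGauge` extension `ext (ext₁ (e^{iθ}))`);
* `plaquette_cfgOfAngle : U_p = e^{i (dθ̃)_p}` (`d = LatticeForm.d₁`), `villainKernel_arg_exp`
  (`φ_β(arg e^{it}) = φ_β(t)`, periodicity), hence
  `zdVillainDensity_cfgOfAngle : ∏_p φ_β(arg U_p) = ∏_p φ_β((dθ̃)_p)`;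
* the abelian Stokes theorem `rectangle_eq_prod_plaquette : U_γ = ∏_{p ∈ S_γ} U_p` (from
  `U1DualRepresentation.monChar_loopCurrent_apply` and `U1DualFluxEnsemble.sum_plaqCurrent_rectPlaqs`),
  `rectangle_cfgOfAngle : U_γ = e^{i ∑_{p ∈ S_γ} (dθ̃)_p}` and
  `zdWilsonLoop_cfgOfAngle : W_γ = cos ∑_{p ∈ S_γ} (dθ̃)_p`;
* the expansion of the Villain weight into Gaussians,
  `prod_villainKernel_eq_tsum : ∏_{p} φ_β(ω_p) = ∑_{m ∈ ℤ^P} e^{-(β/2) ∑_p (ω_p + 2π m_p)²}`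
  (`tsum_pi_prod_real`: a finite product of absolutely convergent series over `ℤ` is the series
  over `ℤ^P` of the products; Tonelli on `ℤ^P` in `ℝ≥0∞`).

Everything is proved; no named fact is introduced.

## References

* J. Fröhlich, T. Spencer, Comm. Math. Phys. 83 (1982) 411–454, §2.2 (2.1)–(2.5), §2.4 (2.19).
  [FrohlichSpencerCMP1982]
-/

noncomputable section

open Finset Function
open scoped ENNReal NNReal
open Literature.Probability.LatticeModels
open Literature.MathematicalPhysics.QuantumLattice (u1Rep)

namespace Literature.MathematicalPhysics.QuantumFieldTheory

/-- Sites of `ℤ^d` (the namespace-local `Site` is the torus one). -/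
local notation "ZSite" => Literature.Probability.LatticeModels.Site

namespace VillainAngle

open AxialGauge LatticeForm

variable {d n : ℕ}

/-! ### Configurations from free link angles -/

variable (d n) in
/-- Real link angles on the free (non-comb) edges of the cube `B_n` (the integration variables
`θ_{xy}` of FS82 (2.3) after axial gauge fixing). [cite: FrohlichSpencerCMP1982, §2.2 (2.3)] -/
abbrev AngleCfg : Type := {e : ↥(boxEdges d n) // ¬ IsComb e.1} → ℝ

/-- Extension of the free link angles by `0` to all links of `ℤ^d` (a comb-gauge real link field
`θ̃`). [folklore] -/
def extAngle (θ : AngleCfg d n) : ZSite d → Fin d → ℝ := fun x i =>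
  if h : (x, i) ∈ boxEdges d n then (if hc : IsComb (x, i) then 0 else θ ⟨⟨(x, i), h⟩, hc⟩) else 0

/-- `θ̃` on a free edge. [folklore] -/
theorem extAngle_apply (θ : AngleCfg d n) (e : {e : ↥(boxEdges d n) // ¬ IsComb e.1}) :
    extAngle θ e.1.1.1 e.1.1.2 = θ e := by
  obtain ⟨⟨⟨x, i⟩, h⟩, hc⟩ := e
  simp [extAngle, h, hc]

/-- `θ̃` is additive in `θ`. [folklore] -/
theorem extAngle_add (θ θ' : AngleCfg d n) : extAngle (θ + θ') = extAngle θ + extAngle θ' := by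
  funext x i
  simp only [extAngle, Pi.add_apply]
  split_ifs <;> simp

/-- `θ̃` is homogeneous in `θ`. [folklore] -/
theorem extAngle_smul (c : ℝ) (θ : AngleCfg d n) : extAngle (c • θ) = c • extAngle θ := by
  funext x i
  simp only [extAngle, Pi.smul_apply, smul_eq_mul]
  split_ifs <;> simp

/-- **The `U(1)` configuration with link variables `e^{iθ̃_e}`** (`1` on the comb tree and off
the cube). [cite: FrohlichSpencerCMP1982, §2.2 (2.1)] -/
def cfgOfAngle (θ : AngleCfg d n) : ZdGaugeConfig d Circle := fun e => Circle.exp (extAngle θ e.1 e.2)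

/-- `cfgOfAngle θ` is the `LatticeAxialGauge` extension of the free-edge configuration `e^{iθ}`.
[folklore] -/
theorem cfgOfAngle_eq_ext_ext₁ (θ : AngleCfg d n) :
    cfgOfAngle θ = ext (ext₁ fun e => Circle.exp (θ e)) := by
  funext ⟨x, i⟩
  simp only [cfgOfAngle, extAngle]
  by_cases h : (x, i) ∈ boxEdges d n
  · rw [ext_apply_of_mem _ h, dif_pos h]
    by_cases hc : IsComb (x, i)
    · rw [dif_pos hc, ext₁_apply_of_isComb _ (show IsComb (⟨(x, i), h⟩ : ↥(boxEdges d n)).1 from hc),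
        Circle.exp_zero]
    · rw [dif_neg hc, ext₁_apply_of_not_isComb _ (show ¬ IsComb (⟨(x, i), h⟩ : ↥(boxEdges d n)).1 from hc)]
  · rw [ext_apply_of_not_mem _ h, dif_neg h, Circle.exp_zero]

/-- **The plaquette variables are `e^{i(dθ̃)_p}`.** [cite: FrohlichSpencerCMP1982, §2.2 (2.2)–(2.3)] -/
theorem plaquette_cfgOfAngle (θ : AngleCfg d n) (x : ZSite d) (i j : Fin d) :
    (cfgOfAngle θ).plaquette x i j = Circle.exp (d₁ (extAngle θ) x i j) := by
  simp only [ZdGaugeConfig.plaquette, cfgOfAngle, d₁, LatticeForm.e]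
  rw [← Circle.exp_neg, ← Circle.exp_neg, ← Circle.exp_add, ← Circle.exp_add, ← Circle.exp_add]
  exact congrArg _ (by ring)

/-! ### The Villain weight in angles -/

/-- `φ_β` is `2π`-periodic. [folklore] -/
theorem villainKernel_periodic (β : ℝ) : Function.Periodic (villainKernel β) (2 * Real.pi) :=
  fun t => villainKernel_add_two_pi β t

/-- `φ_β(arg e^{it}) = φ_β(t)`. [folklore] -/
theorem villainKernel_arg_exp (β t : ℝ) :
    villainKernel β (Complex.arg (Circle.exp t : ℂ)) = villainKernel β t := by
  rw [Circle.coe_exp, Complex.arg_exp_mul_I, ← self_sub_toIocDiv_zsmul]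
  exact (villainKernel_periodic β).sub_zsmul_eq _

/-- **The Villain weight of the cube in angles**: `∏_{p ⊂ Λ} φ_β(arg U_p) = ∏_{p ⊂ Λ} φ_β((dθ̃)_p)`
for `U = cfgOfAngle θ`. [cite: FrohlichSpencerCMP1982, §2.2 (2.3)] -/
theorem zdVillainDensity_cfgOfAngle (β : ℝ) (Λ : Finset (ZSite d)) (θ : AngleCfg d n) :
    zdVillainDensity β Λ (cfgOfAngle θ) =
      ∏ p ∈ plaquettesIn Λ, villainKernel β (d₁ (extAngle θ) p.1 p.2.1 p.2.2) := by
  unfold zdVillainDensity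
  refine Finset.prod_congr rfl fun p _ => ?_
  rw [plaquette_cfgOfAngle, villainKernel_arg_exp]

/-! ### The Wilson loop in angles (abelian Stokes) -/

/-- **Abelian Stokes theorem**: the holonomy of the `R × T` rectangle is the product of the
plaquette variables of its sheet, `U_γ = ∏_{p ∈ S_γ} U_p` (`i ≠ j`). [cite: FrohlichSpencerCMP1982, §2.2 (2.5) and §2.3 (Stokes)] -/
theorem rectangle_eq_prod_plaquette (U : ZdGaugeConfig d Circle) (x : ZSite d) {i j : Fin d}
    (hij : i ≠ j) (R T : ℕ) :
    U.rectangle x i j R T = ∏ p ∈ rectPlaqs x i j R T, U.plaquette p.1 p.2.1 p.2.2 := by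
  rw [← monChar_loopCurrent_apply, ← sum_plaqCurrent_rectPlaqs x hij R T, monChar_sum_apply]
  exact Finset.prod_congr rfl fun p _ => monChar_plaqCurrent_apply p U

/-- `e^{i ∑ f} = ∏ e^{i f}` on `U(1)`. [folklore] -/
theorem circleExp_sum {α : Type*} (s : Finset α) (f : α → ℝ) :
    Circle.exp (∑ a ∈ s, f a) = ∏ a ∈ s, Circle.exp (f a) := by
  classical
  induction s using Finset.induction_on with
  | empty => simp [Circle.exp_zero]
  | insert a s ha ih => rw [Finset.sum_insert ha, Finset.prod_insert ha, Circle.exp_add, ih]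

/-- **The loop holonomy in angles**: `U_γ = e^{i θ(ℒ)}`, `θ(ℒ) = ∑_{p ∈ S_γ} (dθ̃)_p`.
[cite: FrohlichSpencerCMP1982, §2.2 (2.5)] -/
theorem rectangle_cfgOfAngle (θ : AngleCfg d n) (x : ZSite d) {i j : Fin d} (hij : i ≠ j)
    (R T : ℕ) :
    (cfgOfAngle θ).rectangle x i j R T =
      Circle.exp (∑ p ∈ rectPlaqs x i j R T, d₁ (extAngle θ) p.1 p.2.1 p.2.2) := by
  rw [rectangle_eq_prod_plaquette _ x hij, circleExp_sum]
  exact Finset.prod_congr rfl fun p _ => plaquette_cfgOfAngle θ _ _ _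

/-- **The `U(1)` Wilson loop in angles**: `W_γ = cos θ(ℒ)`. [cite: FrohlichSpencerCMP1982, §2.2 (2.5)] -/
theorem zdWilsonLoop_cfgOfAngle (θ : AngleCfg d n) (x : ZSite d) {i j : Fin d} (hij : i ≠ j)
    (R T : ℕ) :
    zdWilsonLoop u1Rep x i j R T (cfgOfAngle θ) =
      Real.cos (∑ p ∈ rectPlaqs x i j R T, d₁ (extAngle θ) p.1 p.2.1 p.2.2) := by
  rw [zdWilsonLoop_u1Rep, reChar]
  change (((monChar (loopCurrent x i j R T)) (cfgOfAngle θ) : Circle) : ℂ).re = _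
  rw [monChar_loopCurrent_apply, rectangle_cfgOfAngle θ x hij, Circle.coe_exp,
    Complex.exp_ofReal_mul_I_re]

/-! ### The Villain weight as a sum of Gaussians -/

/-- Tonelli on `ℤ^k`: `∑_{n : Fin k → ℤ} ∏ᵢ fᵢ(nᵢ) = ∏ᵢ ∑_m fᵢ(m)` in `ℝ≥0∞`. [folklore] -/
theorem tsum_pi_fin_prod : ∀ (k : ℕ) (f : Fin k → ℤ → ℝ≥0∞),
    ∑' m : Fin k → ℤ, ∏ i, f i (m i) = ∏ i, ∑' l, f i l
  | 0, f => by simp [tsum_fintype]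
  | k + 1, f => by
    rw [← (Fin.consEquiv fun _ : Fin (k + 1) => ℤ).tsum_eq, ENNReal.tsum_prod', Fin.prod_univ_succ]
    simp only [Fin.consEquiv_apply, Fin.prod_univ_succ, Fin.cons_zero, Fin.cons_succ]
    rw [← ENNReal.tsum_mul_right]
    refine tsum_congr fun m => ?_
    rw [ENNReal.tsum_mul_left, tsum_pi_fin_prod k fun i => f i.succ]

/-- **Tonelli on `ℤ^ι`** for a finite index type: `∑_{m ∈ ℤ^ι} ∏ᵢ fᵢ(mᵢ) = ∏ᵢ ∑_l fᵢ(l)` in `ℝ≥0∞`.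
[folklore] -/
theorem tsum_pi_prod_ennreal {ι : Type*} [Fintype ι] (f : ι → ℤ → ℝ≥0∞) :
    ∑' m : ι → ℤ, ∏ i, f i (m i) = ∏ i, ∑' l, f i l := by
  classical
  set eq := Fintype.equivFin ι with heq
  set E : (Fin (Fintype.card ι) → ℤ) ≃ (ι → ℤ) := (Equiv.arrowCongr eq (Equiv.refl ℤ)).symm with hE
  rw [← E.tsum_eq]
  have h1 : ∀ m : Fin (Fintype.card ι) → ℤ, ∏ i, f i (E m i) = ∏ j, f (eq.symm j) (m j) := by
    intro m
    refine Fintype.prod_equiv eq _ _ fun i => ?_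
    simp [hE, Equiv.arrowCongr]
  simp_rw [h1]
  rw [tsum_pi_fin_prod, ← Fintype.prod_equiv eq.symm (fun j => ∑' l, f (eq.symm j) l) (fun i => ∑' l, f i l)
    fun j => rfl]

/-- **A finite product of absolutely convergent series over `ℤ` is the series over `ℤ^ι` of the
products** (non-negative terms): summability and the value. [folklore] -/
theorem tsum_pi_prod_real {ι : Type*} [Fintype ι] (f : ι → ℤ → ℝ) (hf : ∀ i l, 0 ≤ f i l)
    (hs : ∀ i, Summable (f i)) :
    Summable (fun m : ι → ℤ => ∏ i, f i (m i)) ∧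
      ∑' m : ι → ℤ, ∏ i, f i (m i) = ∏ i, ∑' l, f i l := by
  have hprod_nonneg : ∀ m : ι → ℤ, 0 ≤ ∏ i, f i (m i) := fun m =>
    Finset.prod_nonneg fun i _ => hf i (m i)
  -- the identity in `ℝ≥0∞`
  have key := tsum_pi_prod_ennreal fun i l => ENNReal.ofReal (f i l)
  have hL : ∀ m : ι → ℤ, ∏ i, ENNReal.ofReal (f i (m i)) = ENNReal.ofReal (∏ i, f i (m i)) := fun m =>
    (ENNReal.ofReal_prod_of_nonneg fun i _ => hf i (m i)).symm
  have hR : ∏ i, ∑' l, ENNReal.ofReal (f i l) = ENNReal.ofReal (∏ i, ∑' l, f i l) := by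
    rw [ENNReal.ofReal_prod_of_nonneg fun i _ => tsum_nonneg (hf i)]
    exact Finset.prod_congr rfl fun i _ => (ENNReal.ofReal_tsum_of_nonneg (hf i) (hs i)).symm
  simp_rw [hL] at key
  rw [hR] at key
  -- summability from finiteness
  have hsum : Summable fun m : ι → ℤ => ∏ i, f i (m i) := by
    set g : (ι → ℤ) → ℝ≥0 := fun m => ⟨∏ i, f i (m i), hprod_nonneg m⟩ with hg
    have hg' : (fun m : ι → ℤ => ∏ i, f i (m i)) = fun m => (g m : ℝ) := rfl
    rw [hg', NNReal.summable_coe]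
    refine ENNReal.tsum_coe_ne_top_iff_summable.1 ?_
    have : (fun m => ((g m : ℝ≥0) : ℝ≥0∞)) = fun m => ENNReal.ofReal (∏ i, f i (m i)) := by
      funext m; rw [hg]; exact (ENNReal.ofReal_eq_coe_nnreal (hprod_nonneg m)).symm
    rw [this, key]
    exact ENNReal.ofReal_ne_top
  refine ⟨hsum, ?_⟩
  rw [← ENNReal.ofReal_tsum_of_nonneg hprod_nonneg hsum] at key
  exact (ENNReal.ofReal_eq_ofReal_iff (tsum_nonneg hprod_nonneg)
    (Finset.prod_nonneg fun i _ => tsum_nonneg (hf i))).1 key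

/-- **The Villain weight as a sum of Gaussians**: for `β > 0` and a real plaquette field `ω` on a
finite set of plaquettes, `∏_p φ_β(ω_p) = ∑_{m ∈ ℤ^P} exp(-(β/2) ∑_p (ω_p + 2π m_p)²)`, the series
converging absolutely (FS82 (2.2)–(2.3) and the first line of the duality transformation, §2.4
(2.19)). [cite: FrohlichSpencerCMP1982, §2.2 (2.2)–(2.3), §2.4 (2.19)] -/
theorem prod_villainKernel_eq_tsum {ι : Type*} [Fintype ι] {β : ℝ} (hβ : 0 < β) (ω : ι → ℝ) :
    Summable (fun m : ι → ℤ => Real.exp (-(β / 2) * ∑ p, (ω p + 2 * Real.pi * m p) ^ 2)) ∧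
      ∏ p, villainKernel β (ω p) =
        ∑' m : ι → ℤ, Real.exp (-(β / 2) * ∑ p, (ω p + 2 * Real.pi * m p) ^ 2) := by
  have h := tsum_pi_prod_real (fun p l => Real.exp (-(β / 2) * (ω p + 2 * Real.pi * l) ^ 2))
    (fun p l => (Real.exp_pos _).le) fun p => summable_villainKernel_term hβ (ω p)
  have hexp : ∀ m : ι → ℤ, ∏ p, Real.exp (-(β / 2) * (ω p + 2 * Real.pi * m p) ^ 2) =
      Real.exp (-(β / 2) * ∑ p, (ω p + 2 * Real.pi * m p) ^ 2) := by
    intro m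
    rw [Finset.mul_sum, Real.exp_sum]
  simp_rw [hexp] at h
  exact ⟨h.1, h.2.symm ▸ rfl⟩

end VillainAngle

end Literature.MathematicalPhysics.QuantumFieldTheory
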